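import Mathlib
import Summits.ResolutionOfSingularities.ResolutionOfSingularities.Theorems.HomologicalConductorPersistenceSurfaceCompletedStep
import Summits.ResolutionOfSingularities.ResolutionOfSingularities.Theorems.HomologicalConductorPersistenceSurfaceSaturationResidualThree
import HarnessLib

/-!
# Rung S-2 `PersistenceSurface` (stmt-ResolutionOfSingularities-19970) — ORDER w44b-o12″:
# the LEVEL-FREE completed-step conjecture CSP‴, its glue, and the doors with the third residual

Route `ResolutionOfSingularities/HomologicalConductor`, chain W4.4b (cell `res-hironaka`, LADDER-RESOLUTION
rung L), rung S-2 `PersistenceSurface` (stmt-ResolutionOfSingularities-19970), door L₄R♮. OURS; nothing here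
is a statement of the manuscript under review (Hironaka 2017) and no statement of that manuscript is used;
AI-written, weaker than expert review. Filed `--supports stmt-ResolutionOfSingularities-19970 --as helper` by
res-type-011 on res-L1-w44b-plan-1's o12′ AMENDMENT (2026-08-27T09:39:01Z) and DE-COLLISION (09:43:30Z:
«011 := o12″»); it sits ON TOP of res-type-010's o12′ file `…PersistenceSurfaceCompletedStep` (p519677: CSP″,
`levelFourPersistenceRationalNormal_of_completedStep`, `persistenceSurface_of_residual₂_of_completedStep_of_rest`)
and res-type-011's third residual cut `…PersistenceSurfaceSaturationResidualThree` (p518900).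

LEVEL BOOKKEEPING (planner, 09:39:01Z). The ascent half of [BahlekehHakimianSalarianTakahashi2015, Thm 4.5 (2)]
climbs WITH A SHIFT — `ca⁴(T_m) ⊆ ca⁶(T̂_m) ∩ T_m` for `d = 2` — so a memo-level proof of CSP″ (target level
FOUR in `T̂_(m+1)`) needs complete-side saturation; but the rung does not need level four at the target:
`PersistenceSurface` (`ca(T_m) ⊆ ca(T_(m+1))`) follows from `Sat₄(T_m)` and «`x ∈ ca⁴(T_m) ⇒ x ∈ ca(T_(m+1))`»,
and the descent [BHST 4.5 (1)] (`caCompletion_comap_le_holds`, p512917, PROVED) is level-wise. Hence: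

* `CompletedStepPersistenceRationalNormal'` — CONJECTURE CSP‴ [OURS]: binders VERBATIM those of CSP″
  (`CompletedStepPersistenceRationalNormal`, p519677), conclusion LEVEL-FREE at the target: the image of
  `x ∈ ca⁴(T_m)` in `T̂_(m+1) := AdicCompletion 𝔪 T_(m+1)` lies in `ca(T̂_(m+1)) = ⋃_N caᴺ(T̂_(m+1))`
  (`cohomologyAnnihilator`; equivalently `∃ N, … ∈ cohomologyAnnihilatorOfDegree _ N` by
  `mem_cohomologyAnnihilator_iff`). The conjecture of record for the door L₄R♮ (CHAIN w44b v12.3);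
* `completedStep'_of_completedStep` — CSP″ ⇒ CSP‴ (`ca⁴ ⊆ ca`);
* `LevelFourPersistenceRationalNormal'`, `LevelFourPersistenceNonnormalOrNonrational'` (= L-other′),
  `LevelFourPersistenceSurface'` — the LEVEL-FREE-TARGET weakenings `caAt 4 (T_m) ⊆ ca (T_(m+1))` of the o6b / o3
  statements (binders VERBATIM), with the free comparisons `…'_of_levelFour` from the level-four forms and the
  excluded-middle glue `levelFourPersistenceSurface'_of_rationalNormal'_of_rest'`;
* `levelFourPersistenceRationalNormal'_of_completedStep'` — GLUE, PROVED: CSP‴ ⇒ `LevelFourPersistenceRationalNormal'`,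
  by `mem_cohomologyAnnihilator_iff` (a level `N`) and the descent `caCompletion_comap_le_holds` AT THAT LEVEL:
  `caᴺ(T̂_(m+1)) ∩ T_(m+1) ⊆ caᴺ(T_(m+1)) ⊆ ca(T_(m+1))`;
* `persistenceSurface_of_saturationFour_of_levelFour'` — `SaturationFourSurface → LevelFourPersistenceSurface' →
  PersistenceSurface` (o3's glue with the last step weakened);
* DOORS: `persistenceSurface_of_residual₃_of_completedStep'_of_rest'` :
  `SaturationFourSurfaceResidual₃ → CSP‴ → LevelFourPersistenceNonnormalOrNonrational' → PersistenceSurface`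
  (the level-free door of record), and the Residual₃ × CSP″ corollary
  `persistenceSurface_of_residual₃_of_completedStep_of_rest` (010's door composed with
  `saturationFourSurfaceResidual₂_of_residual₃`); plus the mixed form `…_of_completedStep_of_rest'`.

The rung thus stands MODULO exactly {`SaturationFourSurfaceResidual₃` («edim ≥ 4» stages), CSP‴ [OURS conjecture],
`LevelFourPersistenceNonnormalOrNonrational'` (Σ6 ∪ Σ8 class, level-free target)} — each a typed Prop carried as a
hypothesis; nothing is asserted.

References: res-L1-w44b-plan-1 CHAIN w44b v12.3 §V12.9, o12′ AMENDMENT 09:39:01Z (OURS); A. Bahlekeh, E. Hakimian,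
S. Salarian, R. Takahashi, *Annihilation of cohomology, generation of modules and finiteness of derived dimension*,
Q. J. Math. 67 (2016) [BahlekehHakimianSalarianTakahashi2015, Thm. 4.5] — the descent (1) is PROVED in the tree
(`…PersistenceFaithfullyFlatDescentCompletion`), the ascent (2) is context only.
-/

set_option linter.dupNamespace false -- mandated namespace `Summit.<Summit>.<Problem>` of this single-conjunct summit

noncomputable section

namespace Summit.ResolutionOfSingularities.ResolutionOfSingularities.Theorems.HomologicalConductor.PersistenceSurfaceCompletedStepLevelFree

open Literature.RingTheory.CohomologyAnnihilator
open Summit.ResolutionOfSingularities.ResolutionOfSingularities.Theorems.NoZeno.Birth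
open Summit.ResolutionOfSingularities.ResolutionOfSingularities.Theorems.HomologicalConductor.PersistenceSurfaceLevelFour
open Summit.ResolutionOfSingularities.ResolutionOfSingularities.Theorems.HomologicalConductor.PersistenceSurfaceNormalPartition
open Summit.ResolutionOfSingularities.ResolutionOfSingularities.Theorems.HomologicalConductor.PersistenceFaithfullyFlatDescentCompletion
open Summit.ResolutionOfSingularities.ResolutionOfSingularities.Theorems.HomologicalConductor.PersistenceSurfaceSaturationResidualTwo
open Summit.ResolutionOfSingularities.ResolutionOfSingularities.Theorems.HomologicalConductor.PersistenceSurfaceSaturationResidualThree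
open Summit.ResolutionOfSingularities.ResolutionOfSingularities.Theorems.HomologicalConductor.PersistenceSurfaceCompletedStep

/-! ## The typed conjecture CSP‴ (level-free target) -/

/-- **CONJECTURE CSP‴ `CompletedStepPersistenceRationalNormal'` [OURS · L1 w44b · CHAIN v12.3 o12″] — COMPLETED
STEP PERSISTENCE with LEVEL-FREE TARGET on the class (R♮):** along the canonical normalised `ca`-tower of a surface
datum `(A, O)` whose stage `0` is normal with a rational singularity or regular (binders VERBATIM those of CSP″
`CompletedStepPersistenceRationalNormal`, hence of `LevelFourPersistenceRationalNormal`), for every step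
`T_m → T_(m+1)` and every `x ∈ ca⁴(T_m)`, the image of `x` in the `𝔪`-adic completion `T̂_(m+1)` lies in the
cohomology annihilator `ca(T̂_(m+1)) = ⋃_N caᴺ(T̂_(m+1))` (SOME level `N`, cf. `mem_cohomologyAnnihilator_iff`).
Weaker than CSP″ (`completedStep'_of_completedStep`) and sufficient for the rung
(`persistenceSurface_of_residual₃_of_completedStep'_of_rest'`). Memo-level route on the reduced-`Z_f` rational
class: BHST 4.5 (2) ascent with shift + (1.1) + (VAL) + (Rec) (res-L1-w44b-tri-1 DC-CUSTODY v2.1 §8; Q12-6′ open).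
A typed Prop consumed only as a hypothesis; NOT a statement of the manuscript under review. -/
@[conjecture]
def CompletedStepPersistenceRationalNormal' : Prop :=
  ∀ p : ℕ, p.Prime → ∀ (k K : Type) [Field k] [CharP k p] [Field K] [Algebra k K]
    (O : ValuationSubring K) (A : Subalgebra k K), (∀ c : k, algebraMap k K c ∈ O) → A.FG →
    IsFractionRing ↥A K → A.toSubring ≤ O.toSubring → ringKrullDim ↥A ≤ 2 →
    ((IsIntegrallyClosed ↥(tower O A 0) ∧
        Literature.AlgebraicGeometry.Resolution.HasRationalSingularity ↥(tower O A 0)) ∨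
      IsRegularLocalRing ↥(tower O A 0)) →
    ∀ (m : ℕ) (hle : tower O A m ≤ tower O A (m + 1))
      [IsNoetherianRing ↥(tower O A (m + 1))] [IsLocalRing ↥(tower O A (m + 1))]
      (x : ↥(tower O A m)), x ∈ cohomologyAnnihilatorOfDegree ↥(tower O A m) 4 →
      algebraMap ↥(tower O A (m + 1))
          (AdicCompletion (IsLocalRing.maximalIdeal ↥(tower O A (m + 1))) ↥(tower O A (m + 1)))
          (Subalgebra.inclusion hle x) ∈
        cohomologyAnnihilator
          (AdicCompletion (IsLocalRing.maximalIdeal ↥(tower O A (m + 1))) ↥(tower O A (m + 1)))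

/-- **CSP″ ⇒ CSP‴** (`ca⁴(T̂_(m+1)) ⊆ ca(T̂_(m+1))`, `cohomologyAnnihilatorOfDegree_le`). [folklore] -/
theorem completedStep'_of_completedStep (hC : CompletedStepPersistenceRationalNormal) :
    CompletedStepPersistenceRationalNormal' := by
  intro p hp k K _ _ _ _ O A hk hA hfr hAO hdim hRN m hle _ _ x hx
  exact cohomologyAnnihilatorOfDegree_le 4 (hC p hp k K O A hk hA hfr hAO hdim hRN m hle x hx)

/-! ## The level-free-target weakenings of the level-four statements -/

/-- [OURS · w44b v12.3 · o12″] `LevelFourPersistenceRationalNormal'` — the LEVEL-FREE-TARGET weakening of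
`LevelFourPersistenceRationalNormal` (o6b, binders VERBATIM): on the class (R♮) («stage 0 normal with a rational
singularity, or regular»), `ca⁴(T_m) ⊆ ca(T_(m+1))` for every `m` (`caAt 4 (T_m) ⊆ ca (T_(m+1))` in the route's
vocabulary). Implied by CSP‴ (`levelFourPersistenceRationalNormal'_of_completedStep'`). NOT a statement of the
manuscript. -/
@[conjecture]
def LevelFourPersistenceRationalNormal' : Prop :=
  ∀ p : ℕ, p.Prime → ∀ (k K : Type) [Field k] [CharP k p] [Field K] [Algebra k K] (O : ValuationSubring K) (A : Subalgebra k K), (∀ c : k, algebraMap k K c ∈ O) → A.FG → IsFractionRing ↥A K → A.toSubring ≤ O.toSubring → ringKrullDim ↥A ≤ 2 → let caAt : ℕ → Subalgebra k K → Set K := fun n A => {x : K | ∃ hx : x ∈ A, ∀ i : ℕ, n ≤ i → ∀ (M N : ModuleCat.{0} ↥A), Module.Finite ↥A M → Module.Finite ↥A N → ∀ e : CategoryTheory.Abelian.Ext.{0} M N i, (⟨x, hx⟩ : ↥A) • e = 0}; let ca : Subalgebra k K → Set K := fun A => {x : K | ∃ hx : x ∈ A, ∃ n : ℕ, ∀ i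 : ℕ, n ≤ i → ∀ (M N : ModuleCat.{0} ↥A), Module.Finite ↥A M → Module.Finite ↥A N → ∀ e : CategoryTheory.Abelian.Ext.{0} M N i, (⟨x, hx⟩ : ↥A) • e = 0}; let loc : Subalgebra k K → Subalgebra k K := fun A => Algebra.adjoin k {y : K | ∃ a ∈ A, ∃ s ∈ A, s⁻¹ ∈ O ∧ y = a * s⁻¹}; let chart : Subalgebra k K → Subalgebra k K := fun A => Algebra.adjoin k ((A : Set K) ∪ {y : K | ∃ c ∈ ca A, ∃ x ∈ ca A, x ≠ 0 ∧ (∀ c' ∈ ca A, c' * x⁻¹ ∈ O) ∧ y = c * x⁻¹}); let nrm : Subalgebra k K → Subalgebra k K := fun B => Algebra.adjoin k {y : K | IsIntegral ↥B y}; let tower : Subalgebra k K → ℕ → Subalgebra k K := fun A m => @Nat.rec (fun _ => Subalgebra k K) (loc A) (fun _ B => loc (nrm (chart B))) m; ((IsIntegrallyClosed ↥(tower A 0) ∧ Literature.AlgebraicGeometry.Resolution.HasRationalSingularity ↥(tower A 0)) ∨ IsRegularLocalRing ↥(tower A 0)) → ∀ m : ℕ, caAt 4 (tower A m) ⊆ ca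 (tower A (m + 1))

/-- [OURS · w44b v12.3 · o12″] `LevelFourPersistenceNonnormalOrNonrational'` (the planner's **L-other′**) — the
LEVEL-FREE-TARGET weakening of `LevelFourPersistenceNonnormalOrNonrational` (o6b, binders VERBATIM): on the
complementary class (stage 0 NOT normal-rational-or-regular: Σ6 ∪ Σ8), `ca⁴(T_m) ⊆ ca(T_(m+1))` for every `m`.
Specimen-driven; a failure here would NOT refute `PersistenceSurface`. NOT a statement of the manuscript. -/
@[conjecture]
def LevelFourPersistenceNonnormalOrNonrational' : Prop :=
  ∀ p : ℕ, p.Prime → ∀ (k K : Type) [Field k] [CharP k p] [Field K] [Algebra k K] (O : ValuationSubring K) (A : Subalgebra k K), (∀ c : k, algebraMap k K c ∈ O) → A.FG → IsFractionRing ↥A K → A.toSubring ≤ O.toSubring → ringKrullDim ↥A ≤ 2 → let caAt : ℕ → Subalgebra k K → Set K := fun n A => {x : K | ∃ hx : x ∈ A, ∀ i : ℕ, n ≤ i → ∀ (M N : ModuleCat.{0} ↥A), Module.Finite ↥A M → Module.Finite ↥A N → ∀ e : CategoryTheory.Abelian.Ext.{0} M N i, (⟨x, hx⟩ : ↥A)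 • e = 0}; let ca : Subalgebra k K → Set K := fun A => {x : K | ∃ hx : x ∈ A, ∃ n : ℕ, ∀ i : ℕ, n ≤ i → ∀ (M N : ModuleCat.{0} ↥A), Module.Finite ↥A M → Module.Finite ↥A N → ∀ e : CategoryTheory.Abelian.Ext.{0} M N i, (⟨x, hx⟩ : ↥A) • e = 0}; let loc : Subalgebra k K → Subalgebra k K := fun A => Algebra.adjoin k {y : K | ∃ a ∈ A, ∃ s ∈ A, s⁻¹ ∈ O ∧ y = a * s⁻¹}; let chart : Subalgebra k K → Subalgebra k K := fun A => Algebra.adjoin k ((A : Set K) ∪ {y : K | ∃ c ∈ ca A, ∃ x ∈ ca A, x ≠ 0 ∧ (∀ c' ∈ ca A, c' * x⁻¹ ∈ O) ∧ y = c * x⁻¹}); let nrm : Subalgebra k K → Subalgebra k K := fun B => Algebra.adjoin k {y : K | IsIntegral ↥B y}; let tower : Subalgebra k K → ℕ → Subalgebra k K := fun A m => @Nat.rec (fun _ => Subalgebra k K) (loc A) (fun _ B => loc (nrm (chart B))) m; ¬ ((IsIntegrallyClosed ↥(tower A 0) ∧ Literature.AlgebraicGeometry.Resolution.HasRationalSingularity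 ↥(tower A 0)) ∨ IsRegularLocalRing ↥(tower A 0)) → ∀ m : ℕ, caAt 4 (tower A m) ⊆ ca (tower A (m + 1))

/-- [OURS · w44b v12.3 · o12″] `LevelFourPersistenceSurface'` — the LEVEL-FREE-TARGET weakening of o3's
`LevelFourPersistenceSurface` (binders VERBATIM those of `Theses.HomologicalConductor.PersistenceSurface` with the
levelled `caAt`): `ca⁴(T_m) ⊆ ca(T_(m+1))` for every stage of every surface tower. With `SaturationFourSurface` it
gives the rung (`persistenceSurface_of_saturationFour_of_levelFour'`). NOT a statement of the manuscript. -/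
@[conjecture]
def LevelFourPersistenceSurface' : Prop :=
  ∀ p : ℕ, p.Prime → ∀ (k K : Type) [Field k] [CharP k p] [Field K] [Algebra k K] (O : ValuationSubring K) (A : Subalgebra k K), (∀ c : k, algebraMap k K c ∈ O) → A.FG → IsFractionRing ↥A K → A.toSubring ≤ O.toSubring → ringKrullDim ↥A ≤ 2 → let caAt : ℕ → Subalgebra k K → Set K := fun n A => {x : K | ∃ hx : x ∈ A, ∀ i : ℕ, n ≤ i → ∀ (M N : ModuleCat.{0} ↥A), Module.Finite ↥A M → Module.Finite ↥A N → ∀ e : CategoryTheory.Abelian.Ext.{0} M N i, (⟨x, hx⟩ : ↥A) • e = 0}; let ca : Subalgebra k K → Set K := fun A => {x : K | ∃ hx : x ∈ A, ∃ n : ℕ, ∀ i : ℕ, n ≤ i → ∀ (M N : ModuleCat.{0} ↥A), Module.Finite ↥A M → Module.Finite ↥A N → ∀ e : CategoryTheory.Abelian.Ext.{0} M N i, (⟨x, hx⟩ : ↥A) • e = 0}; let loc : Subalgebra k K → Subalgebra k K := fun A => Algebra.adjoin k {y : K | ∃ a ∈ A, ∃ s ∈ A, s⁻¹ ∈ O ∧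 y = a * s⁻¹}; let chart : Subalgebra k K → Subalgebra k K := fun A => Algebra.adjoin k ((A : Set K) ∪ {y : K | ∃ c ∈ ca A, ∃ x ∈ ca A, x ≠ 0 ∧ (∀ c' ∈ ca A, c' * x⁻¹ ∈ O) ∧ y = c * x⁻¹}); let nrm : Subalgebra k K → Subalgebra k K := fun B => Algebra.adjoin k {y : K | IsIntegral ↥B y}; let tower : Subalgebra k K → ℕ → Subalgebra k K := fun A m => @Nat.rec (fun _ => Subalgebra k K) (loc A) (fun _ B => loc (nrm (chart B))) m; ∀ m : ℕ, caAt 4 (tower A m) ⊆ ca (tower A (m + 1))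

/-! ## Free comparisons from the level-four forms (`ca⁴ ⊆ ca`) -/

/-- `LevelFourPersistenceRationalNormal → LevelFourPersistenceRationalNormal'`. [folklore] -/
theorem levelFourPersistenceRationalNormal'_of_levelFour (h : LevelFourPersistenceRationalNormal) :
    LevelFourPersistenceRationalNormal' := by
  intro p hp k K _ _ _ _ O A hk hA hfr hAO hdim caAt ca loc chart nrm tower hRN m x hx
  obtain ⟨hx', h4⟩ := h p hp k K O A hk hA hfr hAO hdim hRN m hx
  exact ⟨hx', 4, h4⟩

/-- `LevelFourPersistenceNonnormalOrNonrational → LevelFourPersistenceNonnormalOrNonrational'`. [folklore] -/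
theorem levelFourPersistenceNonnormalOrNonrational'_of_levelFour
    (h : LevelFourPersistenceNonnormalOrNonrational) : LevelFourPersistenceNonnormalOrNonrational' := by
  intro p hp k K _ _ _ _ O A hk hA hfr hAO hdim caAt ca loc chart nrm tower hN m x hx
  obtain ⟨hx', h4⟩ := h p hp k K O A hk hA hfr hAO hdim hN m hx
  exact ⟨hx', 4, h4⟩

/-- `LevelFourPersistenceSurface → LevelFourPersistenceSurface'`. [folklore] -/
theorem levelFourPersistenceSurface'_of_levelFour (h : LevelFourPersistenceSurface) :
    LevelFourPersistenceSurface' := by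
  intro p hp k K _ _ _ _ O A hk hA hfr hAO hdim caAt ca loc chart nrm tower m x hx
  obtain ⟨hx', h4⟩ := h p hp k K O A hk hA hfr hAO hdim m hx
  exact ⟨hx', 4, h4⟩

/-! ## Glue -/

/-- GLUE by excluded middle on the stage-0 predicate: the two classes exhaust all towers. [folklore] -/
theorem levelFourPersistenceSurface'_of_rationalNormal'_of_rest'
    (hR : LevelFourPersistenceRationalNormal') (hN : LevelFourPersistenceNonnormalOrNonrational') :
    LevelFourPersistenceSurface' := by
  intro p hp k K _ _ _ _ O A hk hA hfr hAO hdim caAt ca loc chart nrm tower m x hx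
  rcases Classical.em ((IsIntegrallyClosed ↥(tower A 0) ∧
      Literature.AlgebraicGeometry.Resolution.HasRationalSingularity ↥(tower A 0)) ∨
      IsRegularLocalRing ↥(tower A 0)) with h | h
  · exact hR p hp k K O A hk hA hfr hAO hdim h m hx
  · exact hN p hp k K O A hk hA hfr hAO hdim h m hx

/-- GLUE to the rung (o3's `persistenceSurface_of_saturationFour_of_levelFour` with the last step weakened):
saturation at level four at the source stage + `ca⁴(T_m) ⊆ ca(T_(m+1))` ⇒ `ca(T_m) ⊆ ca(T_(m+1))`. [folklore] -/
theorem persistenceSurface_of_saturationFour_of_levelFour'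
    (hS : SaturationFourSurface) (hL : LevelFourPersistenceSurface') :
    Summit.ResolutionOfSingularities.ResolutionOfSingularities.Theses.HomologicalConductor.PersistenceSurface := by
  intro p hp k K _ _ _ _ O A hk hA hfr hAO hdim ca loc chart nrm tower m x hx
  have hx4 := hS p hp k K O A hk hA hfr hAO hdim m hx
  exact hL p hp k K O A hk hA hfr hAO hdim m hx4

/-- **GLUE [OURS · o12″], PROVED: CSP‴ ⇒ `LevelFourPersistenceRationalNormal'`.** `hC` puts the image of
`x ∈ ca⁴(T_m)` in `ca(T̂_(m+1))`, i.e. in `caᴺ(T̂_(m+1))` for some `N` (`mem_cohomologyAnnihilator_iff`); the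
PROVED descent `caCompletion_comap_le_holds` ([BHST 4.5 (1)], p512917) AT LEVEL `N` pulls it back to
`caᴺ(T_(m+1)) ⊆ ca(T_(m+1))`. Stage instances as in 010's `levelFourPersistenceRationalNormal_of_completedStep`
(`stub_towerNoetherian`, `exists_tower_eq_loc` / `loc_eq_locAt` / `SyzygyFlattening.isLocalRing_locAt`).
[folklore] -/
theorem levelFourPersistenceRationalNormal'_of_completedStep'
    (hC : CompletedStepPersistenceRationalNormal') : LevelFourPersistenceRationalNormal' := by
  intro p hp k K _ _ _ _ O A hk hA hfr hAO hdim caAt ca loc chart nrm tower' hRN m x hx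
  obtain ⟨hxT, hx4⟩ := hx
  have hle : tower O A m ≤ tower O A (m + 1) := fun y hy => by
    rw [tower_succ]
    exact SyzygyFlattening.self_le_locAt O _
      (SyzygyFlattening.self_le_nrm _ (Algebra.subset_adjoin (Or.inl hy)))
  haveI : IsNoetherianRing ↥(tower O A (m + 1)) := stub_towerNoetherian k K O A hk hA hfr hAO _
  haveI : IsLocalRing ↥(tower O A (m + 1)) := by
    obtain ⟨B, hBO, hTB⟩ := exists_tower_eq_loc O A hk hAO (m + 1)
    rw [hTB, loc_eq_locAt]; exact SyzygyFlattening.isLocalRing_locAt O B hBO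
  have hx' : (⟨x, hxT⟩ : ↥(tower O A m)) ∈ cohomologyAnnihilatorOfDegree ↥(tower O A m) 4 :=
    mem_cohomologyAnnihilatorOfDegree_iff.mpr hx4
  have hmem := hC p hp k K O A hk hA hfr hAO hdim hRN m hle ⟨x, hxT⟩ hx'
  obtain ⟨N, hN⟩ := mem_cohomologyAnnihilator_iff.mp hmem
  have hx'' : Subalgebra.inclusion hle ⟨x, hxT⟩ ∈ cohomologyAnnihilatorOfDegree ↥(tower O A (m + 1)) N :=
    caCompletion_comap_le_holds.{0} (↥(tower O A (m + 1))) N (Ideal.mem_comap.mpr hN)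
  exact ⟨hle hxT, N, mem_cohomologyAnnihilatorOfDegree_iff.mp hx''⟩

/-- CSP″ ⇒ `LevelFourPersistenceRationalNormal'` (through CSP‴; also through 010's level-four glue). [folklore] -/
theorem levelFourPersistenceRationalNormal'_of_completedStep (hC : CompletedStepPersistenceRationalNormal) :
    LevelFourPersistenceRationalNormal' :=
  levelFourPersistenceRationalNormal'_of_completedStep' (completedStep'_of_completedStep hC)

/-! ## The doors with the third residual (CHAIN w44b v12.3) -/

/-- **THE LEVEL-FREE S-2 DOOR OF RECORD [OURS · L1 w44b · CHAIN v12.3 o12″]:** the rung `PersistenceSurface`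
follows from the third saturation residual («edim ≥ 4» stages, res-type-011 p518900), the level-free completed-step
conjecture CSP‴ on the normal-rational class, and L-other′ (level-free-target persistence on Σ6 ∪ Σ8) — composing
`saturationFourSurface_of_residual₃`, `levelFourPersistenceRationalNormal'_of_completedStep'`,
`levelFourPersistenceSurface'_of_rationalNormal'_of_rest'` and `persistenceSurface_of_saturationFour_of_levelFour'`.
Every premise is a typed Prop [OURS] carried as a hypothesis; nothing is asserted. [folklore] -/
theorem persistenceSurface_of_residual₃_of_completedStep'_of_rest'
    (hS : SaturationFourSurfaceResidual₃) (hC : CompletedStepPersistenceRationalNormal')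
    (hN : LevelFourPersistenceNonnormalOrNonrational') :
    Summit.ResolutionOfSingularities.ResolutionOfSingularities.Theses.HomologicalConductor.PersistenceSurface :=
  persistenceSurface_of_saturationFour_of_levelFour' (saturationFourSurface_of_residual₃ hS)
    (levelFourPersistenceSurface'_of_rationalNormal'_of_rest'
      (levelFourPersistenceRationalNormal'_of_completedStep' hC) hN)

/-- The same door from the SECOND residual (o9g `SaturationFourSurfaceResidual₂`). [folklore] -/
theorem persistenceSurface_of_residual₂_of_completedStep'_of_rest'
    (hS : SaturationFourSurfaceResidual₂) (hC : CompletedStepPersistenceRationalNormal')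
    (hN : LevelFourPersistenceNonnormalOrNonrational') :
    Summit.ResolutionOfSingularities.ResolutionOfSingularities.Theses.HomologicalConductor.PersistenceSurface :=
  persistenceSurface_of_saturationFour_of_levelFour' (saturationFourSurface_of_residual₂ hS)
    (levelFourPersistenceSurface'_of_rationalNormal'_of_rest'
      (levelFourPersistenceRationalNormal'_of_completedStep' hC) hN)

/-- MIXED FORM: Residual₃ × CSP″ × L-other′ (CSP″ ⇒ CSP‴ by `completedStep'_of_completedStep`). [folklore] -/
theorem persistenceSurface_of_residual₃_of_completedStep_of_rest'
    (hS : SaturationFourSurfaceResidual₃) (hC : CompletedStepPersistenceRationalNormal)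
    (hN : LevelFourPersistenceNonnormalOrNonrational') :
    Summit.ResolutionOfSingularities.ResolutionOfSingularities.Theses.HomologicalConductor.PersistenceSurface :=
  persistenceSurface_of_residual₃_of_completedStep'_of_rest' hS (completedStep'_of_completedStep hC) hN

/-- **Residual₃ × CSP″ corollary of 010's door**: `SaturationFourSurfaceResidual₃ → CompletedStepPersistenceRationalNormal
→ LevelFourPersistenceNonnormalOrNonrational → PersistenceSurface` (`persistenceSurface_of_residual₂_of_completedStep_of_rest`,
p519677, composed with `saturationFourSurfaceResidual₂_of_residual₃`, p518900). [folklore] -/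
theorem persistenceSurface_of_residual₃_of_completedStep_of_rest
    (hS : SaturationFourSurfaceResidual₃) (hC : CompletedStepPersistenceRationalNormal)
    (hN : LevelFourPersistenceNonnormalOrNonrational) :
    Summit.ResolutionOfSingularities.ResolutionOfSingularities.Theses.HomologicalConductor.PersistenceSurface :=
  persistenceSurface_of_residual₂_of_completedStep_of_rest (saturationFourSurfaceResidual₂_of_residual₃ hS) hC hN

end Summit.ResolutionOfSingularities.ResolutionOfSingularities.Theorems.HomologicalConductor.PersistenceSurfaceCompletedStepLevelFree

end
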